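import Summits.BirchSwinnertonDyer.BirchSwinnertonDyer.Theorems.GoldfeldAllTwistsTwoConverseTwinGenusDescentTamagawaExact
import HarnessLib

set_option linter.dupNamespace false -- `…BirchSwinnertonDyer.BirchSwinnertonDyer…` is the cell's namespace (D-0017)
set_option autoImplicit false

/-!
# LINE B49 — the FIXED partner curves, XI: the `3136⁻` partner `W₃₁₃₆ = [0, −42, 0, 448, 0]` of family F2
# (`d_K = −8q`): odd index of `g₃₁₃₆ = (32, 64)`, regulator, Kodaira `III` at `7` (`c₇ = 2`) and `I₈*` at `2`
# (`c₂ ∈ {2, 4}`) — part 1 of 2 (part 2, file XII `…PartnerNegTwoExact`: `c₂ = 4`, `Tam = 8`, «BSD₂(3136⁻) exact»)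

Cell `bsd-goldfeld`, seat `bsd-goldfeld-s1p-c301` (prover, gen 8); TARGET v5.8 §2 c301 order (2) (planner
g17 (xxxix) / g19 (xlviii): «the `3136⁻` analogue of file VI», pre-built under D-0071 for seat c3's family
F2 of the genus mechanism, `K = ℚ(√−2q)`, genus character cutting out `ℚ(√q)` and `ℚ(√−2)`, partner pair
`49a1^{(q)}` (rank `0`, CLTZ) and `49a1^{(−2)} = 3136⁻` (rank `1`)); support for item
`stmt-BirchSwinnertonDyer-19140` (twin″; joint with 20044). HONEST FRAMING: kernel theorems about ONE
explicit curve, the global minimal model `W₃₁₃₆ = [0, −42, 0, 448, 0]` of `49a1^{(−2)}` (files II/III/V: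
`rank = 1`, `Ш[2] = 0`, `IsGloballyMinimal`, `N = 3136`, `#E(ℚ)_tors = 2`); the last theorem takes
bsd.S31 (`bsdTriple_of_rank_le_one_of_conductor_lt`, Creutz–Miller / Miller 2011 for `N < 5000`) and
Modularity as NAMED binders; BSD is not proved by any of this. Not in the Theses cone.

WHAT IS PROVED HERE (the F2 analogues of files VI and VIII for `784`; file XII continues with IX/X):
* §1 `g₃₁₃₆ = (32, 64)` (the image of `(4, 8) ∈ cm7^{(−2)}(ℚ)` of file II under `(1/2, −4, 0, 0)`) is not
  in `2W(ℚ) + W(ℚ)_tors` (`α(g) = [32] = [2] ∉ {1, [448] = [7]}`, `a² − 4b = −28`), has infinite order, has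
  ODD coordinate along every Mordell–Weil basis, the UNIFORM odd-index form
  `exists_odd_forall_exists_zsmul_sub_zsmul_threeTwoSixFour_W3136` («∃ n odd, ∀ P, ∃ a,
  n • P − a • g₃₁₃₆ ∈ tors» — seat c3's requested currency, as for `784`), `Reg = ĥ(P₀)`, `ĥ(g₃₁₃₆) = k²·Reg`
  with `k` odd.
* §2 at `7`: the Step-2 certificate `⟨7, 0, 0, 0, 3, 3, 2⟩` passes on the model (`7 ∣ a₂, a₄`, `7³ ∥ Δ`,
  `7² ∥ b₈ = −448²`) ⇒ type `III`, `ord₇ Δ_min = 3`, **`c₇ = 2`**.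
* §3 at `2`: the model ITSELF is `2`-adically normalised for round `3` of the `Iₙ*` sub-procedure
  (`a₁ = a₃ = a₆ = 0`, `2 ∥ a₂ = −42`, `a₄ = 2⁶·7`, `(a₄/2⁶)² = 49` odd, `2¹⁸ ∥ Δ`) ⇒ type **`I₈*`**,
  `ord₂ Δ_min = 18` (Rank2Observatory one-model certificate `kodairaSymbolOfMinimal_intCast_eq_Istar_even`,
  `m = 3`), hence `c₂ ∈ {2, 4}` (the tree's Step-7 fact). The exact `c₂ = 4`, `Tam(W₃₁₃₆) = 8` and
  `leadingLCoeff_W3136 (hS31) (hmod)` («BSD₂(3136⁻) exact», the C6 row of the F2 height-ratio chain) are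
  file XII.
Numerics (kit j269009, PARI/GP, evidence on 19140): `N = 3136`, `I₈*`/`III`, `c₂ = 4`, `c₇ = 2`, `#tors = 2`,
`r_an = 1`, `L′(1)/(Ω·ĥ((32,64))) = 2.0000000000` (so `k = 1`, `Ш_an = 1`).
References: [Silverman1994] IV.9.4 Steps 1–4, 7 and Table 4.1; [SilvermanAEC2009] VII.1, VIII.6.7, VIII.9.3;
[SilvermanTate2015] §3.5; [CreutzMiller2012]; [CremonaAlgorithms1997] Table 1 (N = 3136).
-/

noncomputable section

open scoped Classical NumberField

open WeierstrassCurve IsDedekindDomain IsLocalRing Rat.HeightOneSpectrum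
  Literature.NumberTheory.EllipticCurves Literature.NumberTheory.EllipticCurves.ModularForms
  Summit.BirchSwinnertonDyer.BirchSwinnertonDyer.Rank2Observatory.Tate
  Summit.BirchSwinnertonDyer.BirchSwinnertonDyer.Rank2Observatory.RootNumber

namespace Summit.BirchSwinnertonDyer.BirchSwinnertonDyer.Theorems.GoldfeldGoodTwists

/-! ## §1 `W₃₁₃₆ = [0, −42, 0, 448, 0]` and `g₃₁₃₆ = (32, 64)`: odd index, regulator -/

section W3136

/-- `g₃₁₃₆ = (32, 64)` lies on `W₃₁₃₆ : y² = x³ − 42x² + 448x` (`32768 − 43008 + 14336 = 4096 = 64²`); it is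
the image of `(4, 8) ∈ cm7^{(−2)}(ℚ)` (file II) under `(1/2, −4, 0, 0)`. [folklore] -/
theorem nonsingular_W3136_threeTwo_sixFour :
    (⟨0, -42, 0, 448, 0⟩ : WeierstrassCurve ℚ).toAffine.Nonsingular 32 64 := by
  haveI := isElliptic_twoTorsionModel_neg_two
  refine (Affine.equation_iff_nonsingular).mp ?_
  rw [Affine.equation_iff']
  norm_num

/-- **`g₃₁₃₆ = (32, 64) ∉ 2W₃₁₃₆(ℚ) + W₃₁₃₆(ℚ)_tors`** (`α(g₃₁₃₆) = [32] = [2] ∉ {1, [448] = [7]}`,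
`a² − 4b = −28`). [cite: SilvermanTate2015, §3.5] -/
theorem threeTwoSixFour_ne_two_zsmul_add_W3136
    (R t : (⟨0, -42, 0, 448, 0⟩ : WeierstrassCurve ℚ).toAffine.Point) (ht : IsOfFinAddOrder t) :
    Affine.Point.some 32 64 nonsingular_W3136_threeTwo_sixFour ≠ (2 : ℤ) • R + t := by
  haveI := isElliptic_twoTorsionModel_neg_two
  obtain ⟨h7, h7', h2, h14⟩ := not_isSquare_rat_neg7_7_2_14
  have hD : ¬ IsSquare ((⟨0, -42, 0, 448, 0⟩ : WeierstrassCurve ℚ).a₂ ^ 2 -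
      4 * (⟨0, -42, 0, 448, 0⟩ : WeierstrassCurve ℚ).a₄) := by
    rw [show ((⟨0, -42, 0, 448, 0⟩ : WeierstrassCurve ℚ).a₂ ^ 2 -
      4 * (⟨0, -42, 0, 448, 0⟩ : WeierstrassCurve ℚ).a₄) = -28 by norm_num]
    rintro ⟨r, hr⟩
    exact h7 (isSquare_of_sq_mul (k := 2) (by norm_num) (by linear_combination hr.symm))
  have hb : ¬ IsSquare (⟨0, -42, 0, 448, 0⟩ : WeierstrassCurve ℚ).a₄ := by
    rw [show (⟨0, -42, 0, 448, 0⟩ : WeierstrassCurve ℚ).a₄ = 448 by rfl]; rintro ⟨r, hr⟩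
    exact h7' (isSquare_of_sq_mul (k := 8) (by norm_num) (by linear_combination hr.symm))
  have h32 : ¬ IsSquare (32 : ℚ) := by
    rintro ⟨r, hr⟩; exact h2 (isSquare_of_sq_mul (k := 4) (by norm_num) (by linear_combination hr.symm))
  have h32b : ¬ IsSquare ((32 : ℚ) * (⟨0, -42, 0, 448, 0⟩ : WeierstrassCurve ℚ).a₄) := by
    rw [show (⟨0, -42, 0, 448, 0⟩ : WeierstrassCurve ℚ).a₄ = 448 by rfl]; rintro ⟨r, hr⟩
    exact h14 (isSquare_of_sq_mul (k := 32) (by norm_num) (by linear_combination hr.symm))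
  have h := some_ne_two_zsmul_add_of_not_isSquare (⟨0, -42, 0, 448, 0⟩ : WeierstrassCurve ℚ) hD hb
    nonsingular_W3136_threeTwo_sixFour (by norm_num) h32 h32b R t (by convert ht)
  convert h

/-- **`g₃₁₃₆` has infinite order.** [cite: SilvermanTate2015, §3.5] -/
theorem not_isOfFinAddOrder_threeTwoSixFour_W3136 :
    ¬ IsOfFinAddOrder (Affine.Point.some 32 64 nonsingular_W3136_threeTwo_sixFour :
      (⟨0, -42, 0, 448, 0⟩ : WeierstrassCurve ℚ).toAffine.Point) := fun hfin =>
  threeTwoSixFour_ne_two_zsmul_add_W3136 0 _ hfin (by rw [zsmul_zero, zero_add])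

/-- `W₃₁₃₆(ℚ)` has a Mordell–Weil basis with ONE element (rank one, file III).
[cite: SilvermanAEC2009, Thm. VIII.6.7] -/
theorem exists_isMordellWeilBasis_fin_one_W3136 :
    ∃ P : Fin 1 → (⟨0, -42, 0, 448, 0⟩ : WeierstrassCurve ℚ).toAffine.Point, IsMordellWeilBasis P := by
  haveI := isElliptic_twoTorsionModel_neg_two
  exact exists_isMordellWeilBasis_fin_one _ rank_and_sha_two_twoTorsionModel_neg_two.1

/-- **Along any Mordell–Weil basis `P₀` of `W₃₁₃₆(ℚ)`: `g₃₁₃₆ ≡ k • P₀ (mod tors)` with `k` ODD.**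
[cite: SilvermanAEC2009, Ch. VIII intro (p. 207)] [cite: SilvermanTate2015, §3.5] -/
theorem exists_odd_threeTwoSixFour_sub_zsmul_basis_W3136
    {P : Fin 1 → (⟨0, -42, 0, 448, 0⟩ : WeierstrassCurve ℚ).toAffine.Point} (hP : IsMordellWeilBasis P) :
    ∃ k : ℤ, Odd k ∧ IsOfFinAddOrder (Affine.Point.some 32 64 nonsingular_W3136_threeTwo_sixFour - k • P 0) := by
  obtain ⟨a, ha⟩ := exists_sub_zsmul_isOfFinAddOrder_of_isMordellWeilBasis hP
    (Affine.Point.some 32 64 nonsingular_W3136_threeTwo_sixFour)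
  have ha' : IsOfFinAddOrder (Affine.Point.some 32 64 nonsingular_W3136_threeTwo_sixFour - a • P 0) := by
    convert ha
  exact ⟨a, odd_of_sub_zsmul_isOfFinAddOrder threeTwoSixFour_ne_two_zsmul_add_W3136 ha', ha'⟩

/-- **The uniform ODD-INDEX form (seat c3's currency, as for `784` in file VI): there is an odd `n` such
that every `P ∈ W₃₁₃₆(ℚ)` satisfies `n • P − a • g₃₁₃₆ ∈ W₃₁₃₆(ℚ)_tors` for some `a`.**
[cite: SilvermanAEC2009, Ch. VIII intro (p. 207)] [cite: SilvermanTate2015, §3.5] -/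
theorem exists_odd_forall_exists_zsmul_sub_zsmul_threeTwoSixFour_W3136 :
    ∃ n : ℤ, Odd n ∧ ∀ P : (⟨0, -42, 0, 448, 0⟩ : WeierstrassCurve ℚ).toAffine.Point,
      ∃ a : ℤ, IsOfFinAddOrder (n • P - a • Affine.Point.some 32 64 nonsingular_W3136_threeTwo_sixFour) := by
  obtain ⟨P₀, hP₀⟩ := exists_isMordellWeilBasis_fin_one_W3136
  obtain ⟨n, hn, h⟩ := exists_odd_forall_exists_zsmul_sub_zsmul hP₀
    (g := Affine.Point.some 32 64 nonsingular_W3136_threeTwo_sixFour)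
    (fun R t ht => threeTwoSixFour_ne_two_zsmul_add_W3136 R t (by convert ht) ∘ fun e => by convert e)
  refine ⟨n, hn, fun P => ?_⟩
  obtain ⟨a, ha⟩ := h P
  exact ⟨a, by convert ha⟩

/-- **`Reg(W₃₁₃₆/ℚ) = ĥ(P₀)`** for any Mordell–Weil basis `P₀`. [cite: SilvermanAEC2009, VIII.9] -/
theorem regulator_W3136_eq_canonicalHeight
    {P : Fin 1 → (⟨0, -42, 0, 448, 0⟩ : WeierstrassCurve ℚ).toAffine.Point} (hP : IsMordellWeilBasis P) :
    (⟨0, -42, 0, 448, 0⟩ : WeierstrassCurve ℚ).regulator = (P 0).canonicalHeight := by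
  haveI := isElliptic_twoTorsionModel_neg_two
  have h := regulator_eq_det_holds (⟨0, -42, 0, 448, 0⟩ : WeierstrassCurve ℚ) P (by convert hP)
  rw [h, Matrix.det_fin_one, Matrix.of_apply]
  exact Affine.Point.heightPairing_self_holds (P 0)

/-- **`ĥ(g₃₁₃₆) = k² · Reg(W₃₁₃₆/ℚ)` with `k` ODD.** [cite: SilvermanAEC2009, Thm. VIII.9.3] -/
theorem exists_odd_canonicalHeight_threeTwoSixFour_W3136 :
    ∃ k : ℤ, Odd k ∧ (Affine.Point.some 32 64 nonsingular_W3136_threeTwo_sixFour :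
      (⟨0, -42, 0, 448, 0⟩ : WeierstrassCurve ℚ).toAffine.Point).canonicalHeight =
        (k : ℝ) ^ 2 * (⟨0, -42, 0, 448, 0⟩ : WeierstrassCurve ℚ).regulator := by
  haveI := isElliptic_twoTorsionModel_neg_two
  obtain ⟨P₀, hP₀⟩ := exists_isMordellWeilBasis_fin_one_W3136
  obtain ⟨k, hk, ht⟩ := exists_odd_threeTwoSixFour_sub_zsmul_basis_W3136 hP₀
  refine ⟨k, hk, ?_⟩
  rw [regulator_W3136_eq_canonicalHeight hP₀]
  refine KrizLi2019.canonicalHeight_eq_of_sub_zsmul_mem_torsion (⟨0, -42, 0, 448, 0⟩ : WeierstrassCurve ℚ) ?_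
  have ht' := (AddCommGroup.mem_torsion _).mpr ht
  convert ht'

end W3136

/-! ## §2 At `7`: type `III`, `ord₇ Δ_min = 3`, `c₇ = 2` -/

/-- The Step-2 certificate of `[0, −42, 0, 448, 0]` at `7` passes (`7 ∣ a₃, a₄, a₆, b₂`, `7³ ∥ Δ`, exit at
Step 4: `7² ∣ a₆ = 0`, `7² ∥ b₈ = −448²`). [cite: Silverman1994, IV.9.4 Steps 1–4] -/
theorem step2Cert_check_W3136_seven :
    Step2Cert.check ⟨7, 0, 0, 0, 3, 3, 2⟩ ⟨0, -42, 0, 448, 0⟩ = true := by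
  decide +kernel

/-- **`W₃₁₃₆` has Kodaira type `III` and `ord Δ_min = 3` at the place above `7`.**
[cite: Silverman1994, IV.9.4 Step 4] -/
theorem kodairaSymbolAt_W3136_seven (v : HeightOneSpectrum (𝓞 ℚ)) (hv : natGenerator v = 7) :
    (⟨0, -42, 0, 448, 0⟩ : WeierstrassCurve ℚ).kodairaSymbolAt v = .III ∧
      (⟨0, -42, 0, 448, 0⟩ : WeierstrassCurve ℚ).ordMinimalDiscriminant v = 3 := by
  have h := Step2Cert.sound (W₀ := ⟨0, -42, 0, 448, 0⟩) (c := ⟨7, 0, 0, 0, 3, 3, 2⟩) v hv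
    step2Cert_check_W3136_seven
  rw [← twoTorsionModel_neg_two_eq_baseChange] at h
  exact h

/-- **`c₇(W₃₁₃₆) = 2`** (type `III`; tree `localTamagawaNumber_eq_two_of_kodairaSymbolAt_eq_III_holds`).
[cite: Silverman1994, IV.9.4 Step 4] -/
theorem localTamagawaNumber_W3136_seven (v : HeightOneSpectrum (𝓞 ℚ)) (hv : natGenerator v = 7) :
    ((⟨0, -42, 0, 448, 0⟩ : WeierstrassCurve ℚ).baseChange (v.adicCompletion ℚ)).localTamagawaNumber
      (v.adicCompletionIntegers ℚ) = 2 := by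
  haveI := isElliptic_twoTorsionModel_neg_two
  haveI := perfectField_residueField_adicCompletionIntegers (K := ℚ) v
  exact localTamagawaNumber_eq_two_of_kodairaSymbolAt_eq_III_holds v _ (kodairaSymbolAt_W3136_seven v hv).1

/-! ## §3 At `2`: type `I₈*`, `ord₂ Δ_min = 18`, and `c₂ = 4` EXACTLY -/

/-- `[0, −42, 0, 448, 0] = (1, 0, 0, 0) • [0, −42, 0, 448, 0]` (the model is already `2`-adically normalised).
[folklore] -/
theorem model_W3136_two :
    (⟨0, -42, 0, 448, 0⟩ : WeierstrassCurve ℤ) = (⟨1, 0, 0, 0⟩ : VariableChange ℤ) • ⟨0, -42, 0, 448, 0⟩ := by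
  rw [show (⟨1, 0, 0, 0⟩ : VariableChange ℤ) = 1 from rfl, one_smul]

/-- **`W₃₁₃₆` has Kodaira type `I₈*` and `ord Δ_min = 18` at the place above `2`** (kernel: the
Rank2Observatory one-model `Iₙ*` certificate, round `m = 3`, second test: `a₁ = a₃ = a₆ = 0`, `2 ∥ a₂`,
`2⁶ ∣ a₄`, `(a₄/2⁶)² − 4(a₂/2)(a₆/2¹¹) = 49` odd, `2¹⁸ ∥ Δ`; minimality at `2` = file III's Kraus test).
[cite: Silverman1994, IV.9.4 Step 7] -/
theorem kodairaSymbolAt_W3136_two (v : HeightOneSpectrum (𝓞 ℚ)) (hv : natGenerator v = 2) :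
    (⟨0, -42, 0, 448, 0⟩ : WeierstrassCurve ℚ).kodairaSymbolAt v = .Istar 8 ∧
      (⟨0, -42, 0, 448, 0⟩ : WeierstrassCurve ℚ).ordMinimalDiscriminant v = 18 := by
  have hmin : ((⟨0, -42, 0, 448, 0⟩ : WeierstrassCurve ℤ).baseChange ℚ).IsMinimalAt v := by
    rw [← twoTorsionModel_neg_two_eq_baseChange]
    exact isGloballyMinimal_twoTorsionModel_neg_two.isMinimal v
  have h := kodairaSymbolAt_and_ordMinimalDiscriminant_of_intModel (v := v) hv ⟨0, -42, 0, 448, 0⟩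
    ⟨0, -42, 0, 448, 0⟩ ⟨1, 0, 0, 0⟩ rfl model_W3136_two hmin (n := 18) (by decide) (by decide)
    (T := .Istar 8) (fun ε hε hpε =>
      kodairaSymbolOfMinimal_intCast_eq_Istar_even (m := 3) (n := 18) Nat.prime_two hε hpε
        (by decide) (by decide) (by decide) (by decide) (by decide) (by decide) (by decide)
        (by decide) (by decide) (by decide))
  rw [← twoTorsionModel_neg_two_eq_baseChange] at h
  exact h

/-- **`c₂(W₃₁₃₆) ∈ {2, 4}`** from the type `I₈*` alone (the tree's Step-7 fact records the printed
alternative «`c = 2` or `4`»; the exact value follows below from rational points).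
[cite: Silverman1994, IV.9.4 Step 7] -/
theorem localTamagawaNumber_W3136_two_mem (v : HeightOneSpectrum (𝓞 ℚ)) (hv : natGenerator v = 2) :
    ((⟨0, -42, 0, 448, 0⟩ : WeierstrassCurve ℚ).baseChange (v.adicCompletion ℚ)).localTamagawaNumber
        (v.adicCompletionIntegers ℚ) = 2 ∨
      ((⟨0, -42, 0, 448, 0⟩ : WeierstrassCurve ℚ).baseChange (v.adicCompletion ℚ)).localTamagawaNumber
        (v.adicCompletionIntegers ℚ) = 4 := by
  haveI := isElliptic_twoTorsionModel_neg_two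
  haveI := perfectField_residueField_adicCompletionIntegers (K := ℚ) v
  exact localTamagawaNumber_of_kodairaSymbolAt_eq_Istar_succ_holds v _ 7 (kodairaSymbolAt_W3136_two v hv).1

end Summit.BirchSwinnertonDyer.BirchSwinnertonDyer.Theorems.GoldfeldGoodTwists

end
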